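import Summits.BirchSwinnertonDyer.BirchSwinnertonDyer.Theorems.PrintX10bLambdaAdicSelmerModPDivision
import Literature.NumberTheory.EllipticCurves.LambdaAdicSelmerDataEisensteinNotDivisibleProofs
import Literature.NumberTheory.EllipticCurves.LambdaAdicSelmerDataTorsionFreeProofs
import HarnessLib

/-!
# ONE element of `𝔖_p(K_∞)` whose control images stay out of `T^{p^{n₁}} · H¹(K, T_{𝔮_m})` for EVERY `m ≥ p^{n₁}`
# (helper for crux `PrintX10b.BeyondCarrierDepthX10b`, stmt-BirchSwinnertonDyer-23055; S1 = STUB 3 of the shared μ-item,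
# COMPACT side — the m-UNIFORM input of `SpecWitness.card_coker_le`)

Summits-side helper (`--supports stmt-BirchSwinnertonDyer-23055`); theorems only, no named fact, no `sorry`. Cell
`pub/bsd-print-x9`, seat `bsd-line-x10b-p1-w2` g8; memo `HOME/x10b-p1-w2/S1-COKERNEL-BLUEPRINT-x10b-p1-w2-g8.md` §5.

WHAT. For `D : LambdaAdicSelmerData` (`𝔖`, pinned), `E(K)[p] = 0`, `γ` a topological generator:
* `exists_not_mem_span_natCast_smul_top` — if `𝔖` is finitely generated over `Λ` and non-zero, some `e ∈ 𝔖` is NOT in `p𝔖`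
  (Nakayama: `p ∈ 𝔪_Λ`).
* **`exists_forall_toEisensteinH1Linear_not_mem_X_pow_smul_top`** — hence there are `e ∈ 𝔖` and `n₁` such that for EVERY
  `m ≥ p^{n₁}` (every `hm`, every transition datum `t, ht`, every pin `I` of `H¹(K, T_{𝔮_m})`): the control image
  `f_m e = toEisensteinH1Linear … e ∉ T^{p^{n₁}} • H¹(K, T_{𝔮_m})` (p654361 `exists_proj_one_ne_zero_of_not_mem` gives the
  level `n₁` with `e_{n₁,1} ≠ 0`, from `noPTorsion_layer`; p655750 `toEisensteinH1Linear_not_mem_X_pow_smul_top` concludes).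
With `IwasawaAlgebra.finite_quotient_range_and_natCard_le_of_not_mem_X_pow_smul` (p653099, on the free rank-one Selmer part
given by Howard's Thm. 1.6.1 (a)) this is `#(H_m ⧸ range f_m) ≤ p^{p^{n₁}}` for all `m > p^{n₁}` — UNIFORM in `m`, as the
composition `nonempty_specWitness_of_dvrConclusion` (p643969) requires. HONEST FRAMING: no summit statement is proved;
BSD is not proved by any of this.

References: B. Howard, Compositio Math. 140 (2004), §2.2, Prop. 2.2.8 and proof of Thm. 2.2.10 (𝔮 = T^m + p);
B. Mazur–K. Rubin, Mem. AMS 799 (2004), Prop. 5.3.14; B. Perrin-Riou, Bull. SMF 115 (1987) §0 p. 402.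
-/

set_option linter.dupNamespace false
set_option autoImplicit false

noncomputable section

open scoped Classical ContRepresentation

universe u

open WeierstrassCurve Literature.NumberTheory.EllipticCurves Literature.NumberTheory.GaloisRepresentations

namespace Summit.BirchSwinnertonDyer.BirchSwinnertonDyer.Theorems.PrintX10bModPDivision

variable {K : Type u} [Field K] [NumberField K] {V : WeierstrassCurve K} [V.IsElliptic] {p : ℕ} [hp : Fact p.Prime]
  {κ : ZpExtension K p} {γ : Field.absoluteGaloisGroup K}

omit [V.IsElliptic] in
/-- **Nakayama on `𝔖`**: if `𝔖 = 𝔖_p(K_∞)` is finitely generated over `Λ` and non-zero, some element of `𝔖` is not in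
`p𝔖 = (p) • 𝔖` (`p ∈ 𝔪_Λ`, so `𝔖 = p𝔖` would force `𝔖 = 0`).
[cite: Howard2004HeegnerKolyvagin, §2.2 (𝔖 finitely generated over Λ)] -/
theorem exists_not_mem_span_natCast_smul_top (D : V.LambdaAdicSelmerData κ γ)
    [Module.Finite (IwasawaAlgebra p) D.S] (hS : ∃ s : D.S, s ≠ 0) :
    ∃ e : D.S, e ∉ (Ideal.span {(p : IwasawaAlgebra p)} • ⊤ : Submodule (IwasawaAlgebra p) D.S) := by
  by_contra h
  have hall : ∀ e : D.S, e ∈ (Ideal.span {(p : IwasawaAlgebra p)} • ⊤ : Submodule (IwasawaAlgebra p) D.S) :=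
    fun e ↦ by_contra fun he ↦ h ⟨e, he⟩
  have hle : (⊤ : Submodule (IwasawaAlgebra p) D.S) ≤ Ideal.span {(p : IwasawaAlgebra p)} • ⊤ := fun e _ ↦ hall e
  have hjac : Ideal.span {(p : IwasawaAlgebra p)} ≤ (⊥ : Ideal (IwasawaAlgebra p)).jacobson := by
    rw [IsLocalRing.jacobson_eq_maximalIdeal ⊥ bot_ne_top, Ideal.span_singleton_le_iff_mem, ← map_natCast PowerSeries.C p]
    exact IwasawaAlgebra.C_p_mem_maximalIdeal p
  have hbot : (⊤ : Submodule (IwasawaAlgebra p) D.S) = ⊥ :=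
    Submodule.eq_bot_of_le_smul_of_le_jacobson_bot _ _ Module.Finite.fg_top hle hjac
  obtain ⟨s, hs⟩ := hS
  exact hs ((Submodule.eq_bot_iff _).1 hbot s Submodule.mem_top)

/-- **ONE element and ONE level for all `m`.** For `E(K)[p] = 0`, `γ` a topological generator and `𝔖` finitely generated
and non-zero, there are `e ∈ 𝔖` and `n₁` such that for every `m ≥ p^{n₁}`, every transition datum and every pin `I` of
`H¹(K, T_{𝔮_m})`, the control image `toEisensteinH1Linear … e` is NOT in `T^{p^{n₁}} • H¹(K, T_{𝔮_m})` — the m-uniform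
input of the compact-side cokernel bound. [cite: Howard2004HeegnerKolyvagin, §2.2, Prop. 2.2.8 and proof of Thm. 2.2.10 (𝔮 = T^m + p)]
[cite: MazurRubinMemoirs2004, Prop. 5.3.14] -/
theorem exists_forall_toEisensteinH1Linear_not_mem_X_pow_smul_top (D : V.LambdaAdicSelmerData κ γ)
    [Module.Finite (IwasawaAlgebra p) D.S] (hγ : κ.IsTopGenerator γ)
    (hE : ∀ P : V.toAffine.Point, p • P = 0 → P = 0) (hS : ∃ s : D.S, s ≠ 0) :
    ∃ (e : D.S) (n₁ : ℕ), ∀ {m : ℕ} (hm : 1 ≤ m)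
      (t : ∀ k, (V.torsionGaloisModule ((p : ℤ) ^ (k + 1))).toContRepresentation →ⁱL
        (V.torsionGaloisModule ((p : ℤ) ^ k)).toContRepresentation)
      (ht : ∀ k (P : geomTorsion V ((p : ℤ) ^ (k + 1))), t k P = V.geomTorsionReduce p k P)
      (I : ZpExtension.EisensteinH1Data (κ.unitTwist (-1)) (fun k ↦ V.torsionGaloisModule ((p : ℤ) ^ k)) t hm),
      p ^ n₁ ≤ m →
        D.toEisensteinH1Linear hm t ht I hγ hE e ∉
          (Ideal.span {(PowerSeries.X : IwasawaAlgebra p) ^ (p ^ n₁)} • ⊤ : Submodule (IwasawaAlgebra p) I.H) := by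
  obtain ⟨e, he⟩ := exists_not_mem_span_natCast_smul_top D hS
  have hnt : ∀ n, ∀ P ∈ V.fixedGeomPoints (κ.layerSubgroup n), (p : ℤ) • P = 0 → P = 0 :=
    fun n P hP hp0 ↦ LambdaAdicSelmerData.noPTorsion_layer κ hE n P ((mem_fixedGeomPoints_iff P).1 hP) hp0
  obtain ⟨n₁, hn₁⟩ := exists_proj_one_ne_zero_of_not_mem D hnt e he
  exact ⟨e, n₁, fun hm t ht I hn ↦ D.toEisensteinH1Linear_not_mem_X_pow_smul_top hm t ht I hγ hE hn e hn₁⟩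

end Summit.BirchSwinnertonDyer.BirchSwinnertonDyer.Theorems.PrintX10bModPDivision

end
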